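import Mathlib.Algebra.Group.Submonoid.Basic
import Mathlib.Algebra.BigOperators.Fin
import Mathlib.Data.Finsupp.Basic
import Mathlib.Data.Finsupp.Order
import Mathlib.Data.Int.GCD
import Mathlib.Tactic.Ring
import Mathlib.Tactic.LinearCombination
import Mathlib.Tactic.FinCases
import HarnessLib

/-!
# Crux `FrobeniusLadder.FRationalResolution` (stmt-ResolutionOfSingularities-15317), line `redirect`,
# stub `stub_diagonalizableQuotientResolution` — THE CONE MAP `ι : Q → ℤⁿ` OF A VERTEX CHART FROM AN INTEGER MATRIX AND A DENOMINATOR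
# (item (β-cert) of MEMO-15317-leafhand2-g25 §3: the last non-finite ingredient of a class certificate)

A vertex chart of a class certificate (`…ConeCertificateResolution`, `…ConeCertificateFreeChart`) presents its cone monoid as
`Q = ⟨G_Q⟩ ⊆ ℕ^{n'}` together with an INJECTIVE ADDITIVE `ι : Q → ℤⁿ` onto `P + ℕ(P − v)`. When `Q` must be presented in prescribed
coordinates (e.g. as a Veronese monoid, so that the vertex certificate `veroneseCone_isRegular_affineBlowup` applies verbatim), `ι` is
in general NOT the restriction of an integer matrix but of a rational one, `ι = L / N`. This file builds such `ι` without any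
definition:

* `exists_matrixHom` — the additive map `L : ℕ^{n'} → ℤⁿ` of an integer matrix `M` (`(L u)ᵢ = Σⱼ uⱼ Mⱼᵢ`);
* `forall_dvd_of_generators` — `N ∣ (L u)ᵢ` on `Q` from the same on the generators `G_Q`;
* ★★ `exists_hom_of_dvd` — `ι : Q → ℤⁿ` with `N • ι = L` on `Q`; `hom_apply_eq_iff` (`ι u = z ↔ ∀ i, (L u)ᵢ = N zᵢ`, the form in which
  the generator checks of `…ConeCertificateGenerators` become integer arithmetic) and `hom_injective` (from injectivity of `L` on `Q`).

Honest label: generic combinatorial helper toward ONE leaf stub (no stub, crux or summit closed). No definitions, no named facts,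
no sorry. [folklore; cite: CoxLittleSchenck2011, §1.2]
-/

-- single-problem summit: the doubled namespace component is forced
set_option linter.dupNamespace false

open scoped BigOperators

namespace Summit.ResolutionOfSingularities.ResolutionOfSingularities.Theorems.FRationalResolution.ConeCertificateGenerators

variable {n n' : ℕ}

/-- **The additive map of an integer matrix** `M : n' × n`: `(L u)ᵢ = Σⱼ uⱼ • Mⱼᵢ` on `ℕ^{n'}` (existence form, no definition).
[folklore] -/
theorem exists_matrixHom (M : Fin n' → Fin n → ℤ) :
    ∃ L : (Fin n' →₀ ℕ) →+ (Fin n →₀ ℤ), ∀ (u : Fin n' →₀ ℕ) (i : Fin n), L u i = ∑ j, (u j : ℤ) * M j i := by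
  refine ⟨AddMonoidHom.mk' (fun u : Fin n' →₀ ℕ => Finsupp.equivFunOnFinite.symm fun i => ∑ j, (u j : ℤ) * M j i) ?_,
    fun u i => rfl⟩
  intro u w
  ext i
  simp only [Finsupp.coe_add, Pi.add_apply, Nat.cast_add, Finsupp.coe_equivFunOnFinite_symm, add_mul,
    Finset.sum_add_distrib]

/-- **Divisibility on `Q` from divisibility on generators**: if `N ∣ (L g)ᵢ` for `g ∈ G_Q` (`⟨G_Q⟩ = Q`) then `N ∣ (L u)ᵢ` for `u ∈ Q`.
[folklore] -/
theorem forall_dvd_of_generators (Q : AddSubmonoid (Fin n' →₀ ℕ)) (L : (Fin n' →₀ ℕ) →+ (Fin n →₀ ℤ)) (N : ℤ)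
    (GQ : Set (Fin n' →₀ ℕ)) (hGQ : AddSubmonoid.closure GQ = Q) (hdvd : ∀ g ∈ GQ, ∀ i, N ∣ L g i) :
    ∀ u : ↥Q, ∀ i, N ∣ L (u : Fin n' →₀ ℕ) i := by
  intro u
  have hu : (u : Fin n' →₀ ℕ) ∈ AddSubmonoid.closure GQ := hGQ ▸ u.2
  suffices key : ∀ x, x ∈ AddSubmonoid.closure GQ → ∀ i, N ∣ L x i from key _ hu
  intro x hx
  induction hx using AddSubmonoid.closure_induction with
  | mem x hx => exact hdvd x hx
  | zero => intro i; rw [map_zero, Finsupp.coe_zero, Pi.zero_apply]; exact dvd_zero N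
  | add x y _ _ ihx ihy => intro i; rw [map_add, Finsupp.coe_add, Pi.add_apply]; exact dvd_add (ihx i) (ihy i)

/-- ★★ **The cone map `ι = L / N` on `Q`.** If `N ≠ 0` divides every coordinate of `L u`, `u ∈ Q`, there is an additive `ι : Q → ℤⁿ`
with `N * (ι u)ᵢ = (L u)ᵢ`. [folklore; cite: CoxLittleSchenck2011, §1.2] -/
theorem exists_hom_of_dvd (Q : AddSubmonoid (Fin n' →₀ ℕ)) (L : (Fin n' →₀ ℕ) →+ (Fin n →₀ ℤ)) (N : ℤ)
    (hdvd : ∀ u : ↥Q, ∀ i, N ∣ L (u : Fin n' →₀ ℕ) i) :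
    ∃ ι : ↥Q →+ (Fin n →₀ ℤ), ∀ (u : ↥Q) (i : Fin n), N * ι u i = L (u : Fin n' →₀ ℕ) i := by
  refine ⟨AddMonoidHom.mk' (fun u : ↥Q => Finsupp.equivFunOnFinite.symm fun i => L (u : Fin n' →₀ ℕ) i / N) ?_,
    fun u i => ?_⟩
  · intro u w
    ext i
    simp only [AddSubmonoid.coe_add, map_add, Finsupp.coe_add, Pi.add_apply, Finsupp.coe_equivFunOnFinite_symm]
    exact Int.add_ediv_of_dvd_left (hdvd u i)
  · simp only [AddMonoidHom.mk'_apply, Finsupp.coe_equivFunOnFinite_symm]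
    exact Int.mul_ediv_cancel' (hdvd u i)

/-- **Values of `ι = L / N`**: `ι u = z ↔ ∀ i, (L u)ᵢ = N zᵢ` (`N ≠ 0`). [folklore] -/
theorem hom_apply_eq_iff (Q : AddSubmonoid (Fin n' →₀ ℕ)) (L : (Fin n' →₀ ℕ) →+ (Fin n →₀ ℤ)) (N : ℤ) (hN : N ≠ 0)
    (ι : ↥Q →+ (Fin n →₀ ℤ)) (hι : ∀ (u : ↥Q) (i : Fin n), N * ι u i = L (u : Fin n' →₀ ℕ) i)
    (u : ↥Q) (z : Fin n →₀ ℤ) : ι u = z ↔ ∀ i, L (u : Fin n' →₀ ℕ) i = N * z i := by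
  constructor
  · rintro rfl i
    exact (hι u i).symm
  · intro h
    ext i
    exact mul_left_cancel₀ hN ((hι u i).trans (h i))

/-- **Injectivity of `ι = L / N`** from injectivity of `L` on `Q`. [folklore] -/
theorem hom_injective (Q : AddSubmonoid (Fin n' →₀ ℕ)) (L : (Fin n' →₀ ℕ) →+ (Fin n →₀ ℤ)) (N : ℤ)
    (ι : ↥Q →+ (Fin n →₀ ℤ)) (hι : ∀ (u : ↥Q) (i : Fin n), N * ι u i = L (u : Fin n' →₀ ℕ) i)
    (hL : ∀ u w : ↥Q, L (u : Fin n' →₀ ℕ) = L (w : Fin n' →₀ ℕ) → u = w) : Function.Injective ι := by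
  intro u w h
  refine hL u w ?_
  ext i
  rw [← hι u i, ← hι w i, h]

/-- **Injectivity of a square integer matrix map on `ℕ²` from its determinant** (the case `n = n' = 2` used by surface classes).
[folklore] -/
theorem matrixHom_injective_two (L : (Fin 2 →₀ ℕ) →+ (Fin 2 →₀ ℤ)) (a b c d : ℤ)
    (h0 : ∀ u : Fin 2 →₀ ℕ, L u 0 = a * (u 0 : ℤ) + b * (u 1 : ℤ)) (h1 : ∀ u : Fin 2 →₀ ℕ, L u 1 = c * (u 0 : ℤ) + d * (u 1 : ℤ))
    (hdet : a * d - b * c ≠ 0) : Function.Injective L := by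
  intro u w h
  have e0 : a * (u 0 : ℤ) + b * (u 1 : ℤ) = a * (w 0 : ℤ) + b * (w 1 : ℤ) := by rw [← h0, ← h0, h]
  have e1 : c * (u 0 : ℤ) + d * (u 1 : ℤ) = c * (w 0 : ℤ) + d * (w 1 : ℤ) := by rw [← h1, ← h1, h]
  have k0 : (a * d - b * c) * ((u 0 : ℤ) - (w 0 : ℤ)) = 0 := by linear_combination d * e0 - b * e1
  have k1 : (a * d - b * c) * ((u 1 : ℤ) - (w 1 : ℤ)) = 0 := by linear_combination a * e1 - c * e0
  have hu0 : (u 0 : ℤ) = (w 0 : ℤ) := by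
    have := (mul_eq_zero.1 k0).resolve_left hdet; omega
  have hu1 : (u 1 : ℤ) = (w 1 : ℤ) := by
    have := (mul_eq_zero.1 k1).resolve_left hdet; omega
  ext i
  fin_cases i
  · exact_mod_cast hu0
  · exact_mod_cast hu1

end Summit.ResolutionOfSingularities.ResolutionOfSingularities.Theorems.FRationalResolution.ConeCertificateGenerators
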